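import Summits.MatrixMultiplication.MatrixMultiplication.Theses.OctaveBudget
import Summits.MatrixMultiplication.MatrixMultiplication.Theorems.LittleCwFarEdgeBound

/-!
# OctaveBudget ⟵ little-CW TRANSFER (cross-route, ω-free dictionary; lens 2 → lens 5)

The landed dictionary `Theorems.LittleCwFarEdgeBound.excess_le_of_littleCwDeficiency`
(`R̃(cw_{k+1}) ≤ k+2+η ⟹ e(k) = ω(1,k,1) − (k+1) ≤ η / log(k+1)`, unconditional) transfers route
`OctaveBudget`'s U-leaf `LinearExcessDecay` (stmt-MatrixMultiplication-25355: `∃ C, ∀ k ≥ 1, e(k) ≤ C/k`) to a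
harmonic-logarithmic decay of the asymptotic-rank deficiency `η_q := R̃(cw_q) − (q+1)` of the little
Coppersmith–Winograd tensors: `η_q ≤ C·log q / q ⟹ LinearExcessDecay`.  Companion of
`Theorems.FarEdgeDescentLittleCwTransfer` (the FarEdgeDescent leaves); kept in its own module so that the two route
files are imported separately.  Support module (`--supports stmt-MatrixMultiplication-25355`); closes no item.
-/

noncomputable section

namespace Summit.MatrixMultiplication.MatrixMultiplication.Theorems.OctaveBudgetLittleCwTransfer

open Literature.Computability.AlgebraicComplexity
open Summit.MatrixMultiplication.MatrixMultiplication.Theorems.LittleCwFarEdgeBound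
  (excess_le_of_littleCwDeficiency)

set_option linter.dupNamespace false

/-- **Cross-route transfer** → route `OctaveBudget`'s `LinearExcessDecay` (stmt-…-25355, lens 5): a
harmonic-logarithmic deficiency `R̃(cw_q) ≤ q + 1 + C·log q/q` gives `e(k) ≤ C'/k`. -/
theorem linearExcessDecay_of_littleCwDeficiencyHarmonic
    (h : ∃ C : ℝ, ∀ q : ℕ, 2 ≤ q →
      asymptoticRank (cwTensor ℂ q) ≤ (q : ℝ) + 1 + C * Real.log (q : ℝ) / (q : ℝ)) :
    Summit.MatrixMultiplication.MatrixMultiplication.Theses.OctaveBudget.LinearExcessDecay := by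
  obtain ⟨C, hC⟩ := h
  refine ⟨max C 0, fun k hk => ?_⟩
  have hkpos : (0 : ℝ) < k := by exact_mod_cast (show 0 < k by omega)
  have hk1pos : (0 : ℝ) < (k : ℝ) + 1 := by linarith
  have hk1 : (1 : ℝ) ≤ k := by exact_mod_cast hk
  have hlog1 : 0 < Real.log ((k : ℝ) + 1) := Real.log_pos (by linarith)
  have hη0 : 0 ≤ max C 0 * Real.log ((k : ℝ) + 1) / ((k : ℝ) + 1) :=
    div_nonneg (mul_nonneg (le_max_right _ _) hlog1.le) hk1pos.le
  have hr : asymptoticRank (cwTensor ℂ (k + 1)) ≤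
      (k : ℝ) + 2 + max C 0 * Real.log ((k : ℝ) + 1) / ((k : ℝ) + 1) := by
    have h0 := hC (k + 1) (by omega)
    push_cast at h0
    have hle : C * Real.log ((k : ℝ) + 1) / ((k : ℝ) + 1) ≤
        max C 0 * Real.log ((k : ℝ) + 1) / ((k : ℝ) + 1) :=
      div_le_div_of_nonneg_right (mul_le_mul_of_nonneg_right (le_max_left _ _) hlog1.le) hk1pos.le
    linarith
  have h1 := excess_le_of_littleCwDeficiency hk hη0 hr
  have e : max C 0 * Real.log ((k : ℝ) + 1) / ((k : ℝ) + 1) / Real.log ((k : ℝ) + 1) =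
      max C 0 / ((k : ℝ) + 1) := by
    rw [div_div, mul_comm ((k : ℝ) + 1), ← div_div, mul_div_cancel_right₀ _ hlog1.ne']
  rw [e] at h1
  have h2 : max C 0 / ((k : ℝ) + 1) ≤ max C 0 / (k : ℝ) :=
    div_le_div_of_nonneg_left (le_max_right _ _) hkpos (by linarith)
  exact h1.trans h2

end Summit.MatrixMultiplication.MatrixMultiplication.Theorems.OctaveBudgetLittleCwTransfer

end
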